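import Summits.CriticalPhenomena.PercolationContinuityZ3.Theorems.PercNearOneGluingNoHeavyLowerTailKnQuestion8CoefficientwiseOffCluster
import Summits.CriticalPhenomena.PercolationContinuityZ3.Theorems.PercNearOneGluingNoHeavyLowerTailKnQuestion8AntitheticProduct
import HarnessLib

/-!
# 'Harris twice': the two-point exclusion `Q_mix(p,q) ≥ H/2 ≥ 0` when one of the two functions is the indicator of `p` (or of `q`) — prim-lf-2 gen 48

Support file (`--supports stmt-CriticalPhenomena-4575`, closed), prover `prim-lf-2` (gen 48).  No definitions, no named facts, no sorries;
standard axioms.  Memo `prim-lf-2/CW-HT-gen48.md`; CONJECTURE Q_mix / NO-CORE: `prim-lf-2/CW-QMIX-gen47.md`, `prim-lf-2/CW-BOX-gen46.md`.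

Setting.  Finite multigraph `ends : ι → Sym2 V`, root `x`; a colouring is `s : Finset ι` (RED edges), `sᶜ` the BLUE edges; `K(s) = C_x(s) =
openCluster (ends '' s) x` is the red cluster of `x`, `K(sᶜ)` the blue one; for `g : Set V → ℝ` monotone put `ĝ(s) = g(K s) − g(K sᶜ)`.
The two-point exclusion of the BOX programme is `Q_mix(p,q) := Σ_{s : ¬(p ∈ K s ∧ q ∈ K sᶜ)} f̂(s)·ĝ(s)`; CONJECTURE Q_mix ≥ 0 for all monotone `f, g`
(0 negatives on all graphs with ≤ 7 vertices / 8 vertices ≤ 12 edges).  Gen 46/47 proved the POSITIONAL cases, all by signing summands TERMWISE.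

This file adds a GLOBAL mechanism, 'Harris twice' = the antithetic kernel of prim-ineq-gen-7 (`AntitheticProduct.sum_mul_sub_compl_nonneg`,
= ½·`harris_twoColouring` by odd pairing): for ANY monotone `c : Finset ι → ℝ` and monotone `B`, `Σ_s c(s)·(B(s) − B(sᶜ)) ≥ 0`
(FKG on the cube gives `Σ c·B ≥ (Σc)(ΣB)/N` and, `B ∘ compl` being antitone, `Σ c·(B∘compl) ≤ (Σc)(ΣB∘compl)/N = (Σc)(ΣB)/N`).  For `f = 1[p ∈ ·]`
the `f`-factor is `σ_p ∈ {1, −1, 0}`: on `{p ∈ K ∖ K̄}` the exclusion keeps exactly `{q ∉ K̄}`, on `{p ∈ K̄ ∖ K}` nothing is excluded and the colour swap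
folds this part onto `+Σ_{p ∈ K ∖ K̄} ĝ`, elsewhere the factor vanishes; so
  `Q_mix(p,q) = Σ_s [p ∈ K s ∖ K sᶜ]·(1 + [q ∉ K sᶜ])·ĝ(s)`,   `H := Σ_s f̂ ĝ = 2·Σ_s [p ∈ K s ∖ K sᶜ]·ĝ(s)`        (`qmix_pointIndicator_eq`, `harris_pointIndicator_eq`)
with the MONOTONE nonnegative weight `[p ∈ K ∖ K̄](1 + [q ∉ K̄])`.  Hence, for every multigraph, root `x`, vertices `p, q` and monotone `g`:
* `qmix_nonneg_of_pointIndicator`      — `0 ≤ Q_mix(p,q)` for `f = 1[p ∈ ·]`;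
* `harris_le_two_qmix_of_pointIndicator` — `H ≤ 2·Q_mix(p,q)`, i.e. `R(p,q) := Σ_{p ∈ K, q ∈ K̄} f̂ĝ ≤ H/2` for `f = 1[p ∈ ·]`;
* `qmix_swap` (`Q_mix(p,q) = Q_mix(q,p)` for swap-symmetric summands) and `qmix_nonneg_of_pointIndicator_right` — the same for `f = 1[q ∈ ·]`
  (and, the summand being symmetric in `f, g`, for `g = 1[p ∈ ·]` or `g = 1[q ∈ ·]`: `qmix_nonneg_of_pointIndicator_snd`).
For the point functions `f = 1_u, g = 1_w` of the lineage this settles `Q_mix(p,q) ≥ 0` whenever `{p,q} ∩ {u,w} ≠ ∅` (gen 47's `qmix_points_nonneg` was the single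
pair `(p,q) = (u,w)`): the Lean-covered share of the ordered `(G,p,q)` point instances rises from 78.9 / 57.3 / 40.0 % to 100 / 89.0 / 76.6 % on 4 / 5 / 6 vertices
(`prim-lf-2/code/gen48/c/coverage48.c`).  The mechanism is sharp in its class: 'Harris twice' signs `Σ_{s∈A} f̂ĝ` iff `(1_A + 1_{Aᶜ'})·f̂` is monotone
(`Aᶜ'` = colour-swapped event), which for the `Q_mix` event holds exactly when `f ∈ {1_p, 1_q}` (memo §2).
[cite: KozmaNitzan2024, Questions 8–9 (§5.5 p. 36) (context: the Question-8 pocket covariance programme)]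
-/

namespace Summit.CriticalPhenomena.PercolationContinuityZ3.Theorems

open Finset Literature.Probability.Percolation

namespace Coefficientwise

section cube

variable {ι : Type*} [Fintype ι] [DecidableEq ι]

/-- The colour swap `s ↦ sᶜ` as an equivalence of the cube (bookkeeping). [cite: KozmaNitzan2024, §5.5 (context only; trivial)] -/
theorem sum_compl_eq (h : Finset ι → ℝ) : ∑ s : Finset ι, h sᶜ = ∑ s : Finset ι, h s :=
  Fintype.sum_equiv (Equiv.mk (fun s : Finset ι => sᶜ) (fun s => sᶜ) (fun s => compl_compl s) (fun s => compl_compl s)) _ _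
    (fun _ => rfl)

end cube

variable {ι V : Type*} [Fintype ι] [DecidableEq ι] (ends : ι → Sym2 V) (x : V)

open Classical in
/-- **Colour-swap symmetry of the two-point exclusion:** for a swap-symmetric summand `F(a,b) = F(b,a)`,
`Σ_{s : ¬(p ∈ K s ∧ q ∈ K sᶜ)} F(K s, K sᶜ) = Σ_{s : ¬(q ∈ K s ∧ p ∈ K sᶜ)} F(K s, K sᶜ)` (reindex by `s ↦ sᶜ`); in particular `Q_mix(p,q) = Q_mix(q,p)` and
`R(p,q) = R(q,p)` for `F = f̂ĝ`.  [cite: KozmaNitzan2024, Questions 8–9 (§5.5 p. 36) (context)] -/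
theorem qmix_swap (p q : V) (F : Set V → Set V → ℝ) (hF : ∀ a b, F a b = F b a) :
    ∑ s ∈ univ.filter (fun s : Finset ι => ¬ (p ∈ openCluster (ends '' (↑s : Set ι)) x ∧ q ∈ openCluster (ends '' (↑(sᶜ) : Set ι)) x)),
      F (openCluster (ends '' (↑s : Set ι)) x) (openCluster (ends '' (↑(sᶜ) : Set ι)) x) =
    ∑ s ∈ univ.filter (fun s : Finset ι => ¬ (q ∈ openCluster (ends '' (↑s : Set ι)) x ∧ p ∈ openCluster (ends '' (↑(sᶜ) : Set ι)) x)),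
      F (openCluster (ends '' (↑s : Set ι)) x) (openCluster (ends '' (↑(sᶜ) : Set ι)) x) := by
  set K : Finset ι → Set V := fun s => openCluster (ends '' (↑s : Set ι)) x with hK
  change ∑ s ∈ univ.filter (fun s : Finset ι => ¬ (p ∈ K s ∧ q ∈ K sᶜ)), F (K s) (K sᶜ) =
    ∑ s ∈ univ.filter (fun s : Finset ι => ¬ (q ∈ K s ∧ p ∈ K sᶜ)), F (K s) (K sᶜ)
  rw [Finset.sum_filter, Finset.sum_filter]
  rw [← sum_compl_eq (fun s : Finset ι => if ¬ (p ∈ K s ∧ q ∈ K sᶜ) then F (K s) (K sᶜ) else 0)]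
  refine Finset.sum_congr rfl fun s _ => ?_
  simp only [compl_compl, hF (K sᶜ) (K s)]
  by_cases hp : p ∈ K sᶜ <;> by_cases hq : q ∈ K s <;> simp [hp, hq]

open Classical in
/-- **The folded form of `Q_mix(p,q)` for `f = 1[p ∈ ·]`.**  With `ĝ(s) = g(K s) − g(K sᶜ)`:
`Σ_{s : ¬(p ∈ K s ∧ q ∈ K sᶜ)} ([p ∈ K s] − [p ∈ K sᶜ])·ĝ(s) = Σ_s [p ∈ K s ∧ p ∉ K sᶜ]·(1 + [q ∉ K sᶜ])·ĝ(s)`.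
(On `{p ∈ K ∖ K̄}` the exclusion keeps exactly `{q ∉ K̄}`; on `{p ∈ K̄ ∖ K}` nothing is excluded and the colour swap maps this part onto `+Σ_{p ∈ K ∖ K̄} ĝ`;
on `{p ∈ K ∩ K̄}` and `{p ∉ K ∪ K̄}` the `f`-factor vanishes.)  [cite: KozmaNitzan2024, Questions 8–9 (§5.5 p. 36) (context)] -/
theorem qmix_pointIndicator_eq (p q : V) (g : Set V → ℝ) :
    ∑ s ∈ univ.filter (fun s : Finset ι => ¬ (p ∈ openCluster (ends '' (↑s : Set ι)) x ∧ q ∈ openCluster (ends '' (↑(sᶜ) : Set ι)) x)),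
      ((if p ∈ openCluster (ends '' (↑s : Set ι)) x then (1 : ℝ) else 0) - (if p ∈ openCluster (ends '' (↑(sᶜ) : Set ι)) x then (1 : ℝ) else 0)) *
        (g (openCluster (ends '' (↑s : Set ι)) x) - g (openCluster (ends '' (↑(sᶜ) : Set ι)) x)) =
    ∑ s : Finset ι, ((if (p ∈ openCluster (ends '' (↑s : Set ι)) x ∧ p ∉ openCluster (ends '' (↑(sᶜ) : Set ι)) x) then (1 : ℝ) else 0) *
        (1 + (if q ∉ openCluster (ends '' (↑(sᶜ) : Set ι)) x then (1 : ℝ) else 0))) *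
      (g (openCluster (ends '' (↑s : Set ι)) x) - g (openCluster (ends '' (↑(sᶜ) : Set ι)) x)) := by
  set K : Finset ι → Set V := fun s => openCluster (ends '' (↑s : Set ι)) x with hK
  set gh : Finset ι → ℝ := fun s => g (K s) - g (K sᶜ) with hgh
  -- the red-only and blue-only indicators of `p`
  set E : Finset ι → ℝ := fun s => if (p ∈ K s ∧ p ∉ K sᶜ) then (1 : ℝ) else 0 with hE
  set D : Finset ι → ℝ := fun s => if (p ∉ K s ∧ p ∈ K sᶜ) then (1 : ℝ) else 0 with hD
  set Qn : Finset ι → ℝ := fun s => if q ∉ K sᶜ then (1 : ℝ) else 0 with hQn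
  change ∑ s ∈ univ.filter (fun s : Finset ι => ¬ (p ∈ K s ∧ q ∈ K sᶜ)),
      ((if p ∈ K s then (1 : ℝ) else 0) - (if p ∈ K sᶜ then (1 : ℝ) else 0)) * gh s =
    ∑ s : Finset ι, (E s * (1 + Qn s)) * gh s
  rw [Finset.sum_filter]
  -- pointwise: the filtered summand is `E·Qn·ĝ − D·ĝ`
  have hpt : ∀ s : Finset ι, (if ¬ (p ∈ K s ∧ q ∈ K sᶜ) then ((if p ∈ K s then (1 : ℝ) else 0) - (if p ∈ K sᶜ then (1 : ℝ) else 0)) * gh s else 0) =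
      E s * Qn s * gh s - D s * gh s := by
    intro s
    simp only [hE, hD, hQn]
    by_cases h1 : p ∈ K s <;> by_cases h2 : p ∈ K sᶜ <;> by_cases h3 : q ∈ K sᶜ <;> simp [h1, h2, h3]
  rw [Finset.sum_congr rfl (fun s _ => hpt s), Finset.sum_sub_distrib]
  -- the colour swap maps the blue-only part onto minus the red-only part
  have hswap : ∑ s : Finset ι, D s * gh s = - ∑ s : Finset ι, E s * gh s := by
    rw [← sum_compl_eq (fun s : Finset ι => D s * gh s), ← Finset.sum_neg_distrib]
    refine Finset.sum_congr rfl fun s _ => ?_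
    have hDE : D sᶜ = E s := by
      simp only [hD, hE, compl_compl]
      by_cases h1 : p ∈ K s <;> by_cases h2 : p ∈ K sᶜ <;> simp [h1, h2]
    have hgg : gh sᶜ = - gh s := by simp only [hgh, compl_compl]; ring
    rw [hDE, hgg]; ring
  rw [hswap, sub_neg_eq_add, ← Finset.sum_add_distrib]
  refine Finset.sum_congr rfl fun s _ => ?_
  ring

open Classical in
/-- **The folded form of the Harris sum for `f = 1[p ∈ ·]`:** `Σ_s ([p ∈ K s] − [p ∈ K sᶜ])·ĝ(s) = 2·Σ_s [p ∈ K s ∧ p ∉ K sᶜ]·ĝ(s)`.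
[cite: KozmaNitzan2024, Questions 8–9 (§5.5 p. 36) (context)] -/
theorem harris_pointIndicator_eq (p : V) (g : Set V → ℝ) :
    ∑ s : Finset ι, ((if p ∈ openCluster (ends '' (↑s : Set ι)) x then (1 : ℝ) else 0) - (if p ∈ openCluster (ends '' (↑(sᶜ) : Set ι)) x then (1 : ℝ) else 0)) *
        (g (openCluster (ends '' (↑s : Set ι)) x) - g (openCluster (ends '' (↑(sᶜ) : Set ι)) x)) =
    2 * ∑ s : Finset ι, (if (p ∈ openCluster (ends '' (↑s : Set ι)) x ∧ p ∉ openCluster (ends '' (↑(sᶜ) : Set ι)) x) then (1 : ℝ) else 0) *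
      (g (openCluster (ends '' (↑s : Set ι)) x) - g (openCluster (ends '' (↑(sᶜ) : Set ι)) x)) := by
  set K : Finset ι → Set V := fun s => openCluster (ends '' (↑s : Set ι)) x with hK
  set gh : Finset ι → ℝ := fun s => g (K s) - g (K sᶜ) with hgh
  set E : Finset ι → ℝ := fun s => if (p ∈ K s ∧ p ∉ K sᶜ) then (1 : ℝ) else 0 with hE
  set D : Finset ι → ℝ := fun s => if (p ∉ K s ∧ p ∈ K sᶜ) then (1 : ℝ) else 0 with hD
  change ∑ s : Finset ι, ((if p ∈ K s then (1 : ℝ) else 0) - (if p ∈ K sᶜ then (1 : ℝ) else 0)) * gh s = 2 * ∑ s : Finset ι, E s * gh s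
  have hpt : ∀ s : Finset ι, ((if p ∈ K s then (1 : ℝ) else 0) - (if p ∈ K sᶜ then (1 : ℝ) else 0)) * gh s = E s * gh s - D s * gh s := by
    intro s
    simp only [hE, hD]
    by_cases h1 : p ∈ K s <;> by_cases h2 : p ∈ K sᶜ <;> simp [h1, h2]
  rw [Finset.sum_congr rfl (fun s _ => hpt s), Finset.sum_sub_distrib]
  have hswap : ∑ s : Finset ι, D s * gh s = - ∑ s : Finset ι, E s * gh s := by
    rw [← sum_compl_eq (fun s : Finset ι => D s * gh s), ← Finset.sum_neg_distrib]
    refine Finset.sum_congr rfl fun s _ => ?_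
    have hDE : D sᶜ = E s := by
      simp only [hD, hE, compl_compl]
      by_cases h1 : p ∈ K s <;> by_cases h2 : p ∈ K sᶜ <;> simp [h1, h2]
    have hgg : gh sᶜ = - gh s := by simp only [hgh, compl_compl]; ring
    rw [hDE, hgg]; ring
  rw [hswap]; ring

open Classical in
/-- **THEOREM (Harris twice): `Q_mix(p,q) ≥ 0` when `f` is the indicator of `p`.**  For every finite multigraph, root `x`, vertices `p, q` and monotone
`g : Set V → ℝ`: `0 ≤ Σ_{s : ¬(p ∈ K s ∧ q ∈ K sᶜ)} ([p ∈ K s] − [p ∈ K sᶜ])·(g(K s) − g(K sᶜ))`.  Proof: `qmix_pointIndicator_eq` + `AntitheticProduct.sum_mul_sub_compl_nonneg` with the monotone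
weight `[p ∈ K ∖ K̄](1 + [q ∉ K̄])`.  For the point functions (`g = 1_w`) this is CONJECTURE Q_mix for every pair with `p = u`; NOT a termwise statement.
[cite: KozmaNitzan2024, Questions 8–9 (§5.5 p. 36) (context)] -/
theorem qmix_nonneg_of_pointIndicator (p q : V) (g : Set V → ℝ) (hg : Monotone g) :
    0 ≤ ∑ s ∈ univ.filter (fun s : Finset ι => ¬ (p ∈ openCluster (ends '' (↑s : Set ι)) x ∧ q ∈ openCluster (ends '' (↑(sᶜ) : Set ι)) x)),
      ((if p ∈ openCluster (ends '' (↑s : Set ι)) x then (1 : ℝ) else 0) - (if p ∈ openCluster (ends '' (↑(sᶜ) : Set ι)) x then (1 : ℝ) else 0)) *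
        (g (openCluster (ends '' (↑s : Set ι)) x) - g (openCluster (ends '' (↑(sᶜ) : Set ι)) x)) := by
  rw [qmix_pointIndicator_eq ends x p q g]
  set K : Finset ι → Set V := fun s => openCluster (ends '' (↑s : Set ι)) x with hK
  have hKmono : ∀ {s t : Finset ι}, s ⊆ t → K s ⊆ K t := fun hst => openCluster_image_mono ends hst x
  refine AntitheticProduct.sum_mul_sub_compl_nonneg
    (fun s : Finset ι => (if (p ∈ K s ∧ p ∉ K sᶜ) then (1 : ℝ) else 0) * (1 + (if q ∉ K sᶜ then (1 : ℝ) else 0)))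
    (fun s : Finset ι => g (K s)) ?_ (fun s t hst => hg (hKmono hst))
  intro s t hst
  have hc : K tᶜ ⊆ K sᶜ := hKmono (compl_subset_compl.mpr hst)
  have h1 : (if (p ∈ K s ∧ p ∉ K sᶜ) then (1 : ℝ) else 0) ≤ (if (p ∈ K t ∧ p ∉ K tᶜ) then (1 : ℝ) else 0) := by
    by_cases hs : p ∈ K s ∧ p ∉ K sᶜ
    · have ht : p ∈ K t ∧ p ∉ K tᶜ := ⟨hKmono hst hs.1, fun h => hs.2 (hc h)⟩
      simp [hs, ht]
    · simp only [hs, if_false]; split_ifs <;> norm_num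
  have h2 : (1 + (if q ∉ K sᶜ then (1 : ℝ) else 0)) ≤ (1 + (if q ∉ K tᶜ then (1 : ℝ) else 0)) := by
    by_cases hs : q ∉ K sᶜ
    · have ht : q ∉ K tᶜ := fun h => hs (hc h)
      simp [hs, ht]
    · simp only [hs, if_false]; split_ifs <;> norm_num
  have h0 : 0 ≤ (if (p ∈ K t ∧ p ∉ K tᶜ) then (1 : ℝ) else 0) := by split_ifs <;> norm_num
  have h0' : 0 ≤ (1 + (if q ∉ K sᶜ then (1 : ℝ) else 0)) := by split_ifs <;> norm_num
  exact mul_le_mul h1 h2 h0' h0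

open Classical in
/-- **`R(p,q) ≤ H/2` for `f = 1[p ∈ ·]`:** `Σ_s f̂ĝ ≤ 2·Σ_{s : ¬(p ∈ K s ∧ q ∈ K sᶜ)} f̂ĝ`, i.e. `Q_mix(p,q) ≥ H/2` — the excluded sum `R(p,q) = H − Q_mix` is at most
half the Harris sum.  (`2·Q_mix − H = 2·Σ_s [p ∈ K ∖ K̄][q ∉ K̄]·ĝ ≥ 0` by `AntitheticProduct.sum_mul_sub_compl_nonneg`.)  [cite: KozmaNitzan2024, Questions 8–9 (§5.5 p. 36) (context)] -/
theorem harris_le_two_qmix_of_pointIndicator (p q : V) (g : Set V → ℝ) (hg : Monotone g) :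
    ∑ s : Finset ι, ((if p ∈ openCluster (ends '' (↑s : Set ι)) x then (1 : ℝ) else 0) - (if p ∈ openCluster (ends '' (↑(sᶜ) : Set ι)) x then (1 : ℝ) else 0)) *
        (g (openCluster (ends '' (↑s : Set ι)) x) - g (openCluster (ends '' (↑(sᶜ) : Set ι)) x)) ≤
    2 * ∑ s ∈ univ.filter (fun s : Finset ι => ¬ (p ∈ openCluster (ends '' (↑s : Set ι)) x ∧ q ∈ openCluster (ends '' (↑(sᶜ) : Set ι)) x)),
      ((if p ∈ openCluster (ends '' (↑s : Set ι)) x then (1 : ℝ) else 0) - (if p ∈ openCluster (ends '' (↑(sᶜ) : Set ι)) x then (1 : ℝ) else 0)) *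
        (g (openCluster (ends '' (↑s : Set ι)) x) - g (openCluster (ends '' (↑(sᶜ) : Set ι)) x)) := by
  rw [qmix_pointIndicator_eq ends x p q g, harris_pointIndicator_eq ends x p g]
  set K : Finset ι → Set V := fun s => openCluster (ends '' (↑s : Set ι)) x with hK
  have hKmono : ∀ {s t : Finset ι}, s ⊆ t → K s ⊆ K t := fun hst => openCluster_image_mono ends hst x
  -- `2·Q_mix − H = 2·Σ [p ∈ K∖K̄][q ∉ K̄]·ĝ ≥ 0`
  have hpos : 0 ≤ ∑ s : Finset ι, ((if (p ∈ K s ∧ p ∉ K sᶜ) then (1 : ℝ) else 0) * (if q ∉ K sᶜ then (1 : ℝ) else 0)) *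
      (g (K s) - g (K sᶜ)) := by
    refine AntitheticProduct.sum_mul_sub_compl_nonneg
      (fun s : Finset ι => (if (p ∈ K s ∧ p ∉ K sᶜ) then (1 : ℝ) else 0) * (if q ∉ K sᶜ then (1 : ℝ) else 0))
      (fun s : Finset ι => g (K s)) ?_ (fun s t hst => hg (hKmono hst))
    intro s t hst
    have hc : K tᶜ ⊆ K sᶜ := hKmono (compl_subset_compl.mpr hst)
    have h1 : (if (p ∈ K s ∧ p ∉ K sᶜ) then (1 : ℝ) else 0) ≤ (if (p ∈ K t ∧ p ∉ K tᶜ) then (1 : ℝ) else 0) := by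
      by_cases hs : p ∈ K s ∧ p ∉ K sᶜ
      · have ht : p ∈ K t ∧ p ∉ K tᶜ := ⟨hKmono hst hs.1, fun h => hs.2 (hc h)⟩
        simp [hs, ht]
      · simp only [hs, if_false]; split_ifs <;> norm_num
    have h2 : (if q ∉ K sᶜ then (1 : ℝ) else 0) ≤ (if q ∉ K tᶜ then (1 : ℝ) else 0) := by
      by_cases hs : q ∉ K sᶜ
      · have ht : q ∉ K tᶜ := fun h => hs (hc h)
        simp [hs, ht]
      · simp only [hs, if_false]; split_ifs <;> norm_num
    have h0 : 0 ≤ (if (p ∈ K t ∧ p ∉ K tᶜ) then (1 : ℝ) else 0) := by split_ifs <;> norm_num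
    have h0' : 0 ≤ (if q ∉ K sᶜ then (1 : ℝ) else 0) := by split_ifs <;> norm_num
    exact mul_le_mul h1 h2 h0' h0
  have hid : ∑ s : Finset ι, ((if (p ∈ K s ∧ p ∉ K sᶜ) then (1 : ℝ) else 0) * (1 + (if q ∉ K sᶜ then (1 : ℝ) else 0))) * (g (K s) - g (K sᶜ)) =
      ∑ s : Finset ι, (if (p ∈ K s ∧ p ∉ K sᶜ) then (1 : ℝ) else 0) * (g (K s) - g (K sᶜ)) +
      ∑ s : Finset ι, ((if (p ∈ K s ∧ p ∉ K sᶜ) then (1 : ℝ) else 0) * (if q ∉ K sᶜ then (1 : ℝ) else 0)) * (g (K s) - g (K sᶜ)) := by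
    rw [← Finset.sum_add_distrib]
    refine Finset.sum_congr rfl fun s _ => ?_
    ring
  simp only [hK] at hid hpos
  rw [hid]
  linarith

open Classical in
/-- **`Q_mix(p,q) ≥ 0` when `f` is the indicator of `q`** (by `qmix_swap` from the `p`-case). [cite: KozmaNitzan2024, Questions 8–9 (§5.5 p. 36) (context)] -/
theorem qmix_nonneg_of_pointIndicator_right (p q : V) (g : Set V → ℝ) (hg : Monotone g) :
    0 ≤ ∑ s ∈ univ.filter (fun s : Finset ι => ¬ (p ∈ openCluster (ends '' (↑s : Set ι)) x ∧ q ∈ openCluster (ends '' (↑(sᶜ) : Set ι)) x)),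
      ((if q ∈ openCluster (ends '' (↑s : Set ι)) x then (1 : ℝ) else 0) - (if q ∈ openCluster (ends '' (↑(sᶜ) : Set ι)) x then (1 : ℝ) else 0)) *
        (g (openCluster (ends '' (↑s : Set ι)) x) - g (openCluster (ends '' (↑(sᶜ) : Set ι)) x)) := by
  rw [qmix_swap ends x p q (fun a b => ((if q ∈ a then (1 : ℝ) else 0) - (if q ∈ b then (1 : ℝ) else 0)) * (g a - g b)) (fun a b => by ring)]
  exact qmix_nonneg_of_pointIndicator ends x q p g hg

open Classical in
/-- **`Q_mix(p,q) ≥ 0` when the SECOND function is the indicator of `p` or of `q`** (the summand is symmetric in `f, g`).  With `f = 1_w` monotone arbitrary and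
`g = 1_u`: for the lineage's point functions CONJECTURE Q_mix holds whenever `{p,q} ∩ {u,w} ≠ ∅`. [cite: KozmaNitzan2024, Questions 8–9 (§5.5 p. 36) (context)] -/
theorem qmix_nonneg_of_pointIndicator_snd (p q r : V) (hr : r = p ∨ r = q) (f : Set V → ℝ) (hf : Monotone f) :
    0 ≤ ∑ s ∈ univ.filter (fun s : Finset ι => ¬ (p ∈ openCluster (ends '' (↑s : Set ι)) x ∧ q ∈ openCluster (ends '' (↑(sᶜ) : Set ι)) x)),
      (f (openCluster (ends '' (↑s : Set ι)) x) - f (openCluster (ends '' (↑(sᶜ) : Set ι)) x)) *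
        ((if r ∈ openCluster (ends '' (↑s : Set ι)) x then (1 : ℝ) else 0) - (if r ∈ openCluster (ends '' (↑(sᶜ) : Set ι)) x then (1 : ℝ) else 0)) := by
  have hcomm := Finset.sum_congr (rfl : univ.filter (fun s : Finset ι => ¬ (p ∈ openCluster (ends '' (↑s : Set ι)) x ∧ q ∈ openCluster (ends '' (↑(sᶜ) : Set ι)) x)) = _)
    (fun s _ => mul_comm
      (f (openCluster (ends '' (↑s : Set ι)) x) - f (openCluster (ends '' (↑(sᶜ) : Set ι)) x))
      ((if r ∈ openCluster (ends '' (↑s : Set ι)) x then (1 : ℝ) else 0) - (if r ∈ openCluster (ends '' (↑(sᶜ) : Set ι)) x then (1 : ℝ) else 0)))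
  rw [hcomm]
  rcases hr with rfl | rfl
  · exact qmix_nonneg_of_pointIndicator ends x r q f hf
  · exact qmix_nonneg_of_pointIndicator_right ends x p r f hf


/-!
### Appendix (gen 48, same session): the exact reach of 'Harris twice' — the fold criterion

For an event `A` on the colouring cube and a swap-odd `Φ` (`Φ sᶜ = −Φ s`, e.g. `Φ = f̂`), the sum `Σ_{s∈A} Φ·(B − B∘compl)` equals `½·Σ_s (1_A(s) + 1_A(sᶜ))·Φ(s)·(B s − B sᶜ)`;
so whenever the FOLD `s ↦ (1_A(s) + 1_A(sᶜ))·Φ(s)` is monotone, the antithetic kernel signs it for every monotone `B`.  The two theorem files of gen 48 (`f = 1_p`: fold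
`2·[p ∈ K∖K̄](1+[q ∉ K̄]) −`(swap); `f` needing both `p,q`) are the instances where this fold is monotone for the `Q_mix` event (memo CW-HT-gen48 §2: these are all of them
among functions of `p, q` and a third vertex).
-/

section criterion

variable {ι : Type*} [Fintype ι] [DecidableEq ι]

/-- **The fold criterion for 'Harris twice'.**  Let `A` be any event on the cube, `Φ` swap-odd (`Φ sᶜ = −Φ s`), `B` monotone, and suppose the fold
`s ↦ ((1_A s) + (1_A sᶜ))·Φ s` is monotone.  Then `0 ≤ Σ_{s ∈ A} Φ s · (B s − B sᶜ)`.  (`Σ_A Φ(B−B∘c) = ½ Σ fold·(B−B∘c)` by reindexing the `1_A(sᶜ)` half with the swap, then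
`AntitheticProduct.sum_mul_sub_compl_nonneg`.)  [cite: KozmaNitzan2024, Questions 8–9 (§5.5 p. 36) (context)] -/
theorem event_twoColouring_nonneg_of_fold_monotone (A : Finset ι → Prop) [DecidablePred A] (Φ B : Finset ι → ℝ)
    (hΦ : ∀ s : Finset ι, Φ sᶜ = - Φ s) (hB : Monotone B)
    (hfold : Monotone (fun s : Finset ι => ((if A s then (1 : ℝ) else 0) + (if A sᶜ then (1 : ℝ) else 0)) * Φ s)) :
    0 ≤ ∑ s ∈ univ.filter (fun s : Finset ι => A s), Φ s * (B s - B sᶜ) := by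
  have hker := AntitheticProduct.sum_mul_sub_compl_nonneg
    (fun s : Finset ι => ((if A s then (1 : ℝ) else 0) + (if A sᶜ then (1 : ℝ) else 0)) * Φ s) B hfold hB
  -- the `1_A(sᶜ)` half equals the `1_A(s)` half after the swap
  have hhalf : ∑ s : Finset ι, (if A sᶜ then (1 : ℝ) else 0) * Φ s * (B s - B sᶜ) = ∑ s : Finset ι, (if A s then (1 : ℝ) else 0) * Φ s * (B s - B sᶜ) := by
    rw [← sum_compl_eq (fun s : Finset ι => (if A sᶜ then (1 : ℝ) else 0) * Φ s * (B s - B sᶜ))]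
    refine Finset.sum_congr rfl fun s _ => ?_
    simp only [compl_compl, hΦ s]
    ring
  have hsum : ∑ s : Finset ι, (((if A s then (1 : ℝ) else 0) + (if A sᶜ then (1 : ℝ) else 0)) * Φ s) * (B s - B sᶜ) =
      2 * ∑ s ∈ univ.filter (fun s : Finset ι => A s), Φ s * (B s - B sᶜ) := by
    have hsplit : ∑ s : Finset ι, (((if A s then (1 : ℝ) else 0) + (if A sᶜ then (1 : ℝ) else 0)) * Φ s) * (B s - B sᶜ) =
        ∑ s : Finset ι, (if A s then (1 : ℝ) else 0) * Φ s * (B s - B sᶜ) + ∑ s : Finset ι, (if A sᶜ then (1 : ℝ) else 0) * Φ s * (B s - B sᶜ) := by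
      rw [← Finset.sum_add_distrib]
      refine Finset.sum_congr rfl fun s _ => ?_
      ring
    rw [hsplit, hhalf, Finset.sum_filter]
    have : ∀ s : Finset ι, (if A s then (1 : ℝ) else 0) * Φ s * (B s - B sᶜ) = (if A s then Φ s * (B s - B sᶜ) else 0) := fun s => by
      split_ifs <;> ring
    simp only [this]
    ring
  rw [hsum] at hker
  linarith

end criterion

end Coefficientwise

end Summit.CriticalPhenomena.PercolationContinuityZ3.Theorems
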